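import Summits.RiemannHypothesis.RiemannHypothesis.Theorems.GroundBartaPolarPerronFrobeniusRitzSignNearBottom
import Summits.RiemannHypothesis.RiemannHypothesis.Theorems.WeilFormatCDataA1RungCB
import Literature.NumberTheory.LFunctions.WeilGroundEnergyProofs
import HarnessLib

/-!
# GroundBarta / PolarPerronFrobenius (stmt-RiemannHypothesis-18390): the cone gap at `a = 83/100` and on `[4023/5000, 83/100]`, UNCONDITIONALLY

Helper file (`--supports stmt-RiemannHypothesis-18390`), RH-free, pure logic.  Prover A (g21 of unit `sr-gb-rung-a`) for prover B g16
(successor task of `…RitzSignNearBottom`, HOME(B)/g16/work/NearBottom83Uncond.APPEND.lean): B's landed `coneGap_83_le` and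
`coneGap_le_of_mem_Icc_8046` (`…PolarPerronFrobeniusRitzSignNearBottom`, p396628) take the positivity `0 ≤ ε(83/100)` of the W-M2 cell as
a hypothesis; that positivity is meanwhile a THEOREM OF THE TREE by a different route — W-M4 `WeilFormatCData.A1.weilPositivityOn_one`
(weil-2, p393632: `WeilPositivityOn 1`, format C) restricted to the window `83/100 ≤ 1` (`WeilPositivityOn.mono`) and turned into
`0 ≤ weilGroundEnergy (83/100)` by `weilGroundEnergy_nonneg_iff_holds` — so both cone-gap statements hold unconditionally:
* `weilGroundEnergy_83_nonneg_of_one` : `0 ≤ ε(83/100)`;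
* `coneGap_83` : `0 ≤ ε₊(83/100) − ε(83/100) ≤ 483·10⁻²¹`;
* `coneGap_le_of_mem_Icc_8046_83` : `0 ≤ ε₊(a) − ε(a) ≤ 10⁻¹⁷` for every `a ∈ [4023/5000, 83/100]`.
(`ε₊` = the cone bottom over nonneg real window tests, `sInf (weilWindowSphereValues …)`; `GroundStateSimplePositive a ⟺ gap = 0`, B seat 3.)
-/

set_option linter.dupNamespace false

noncomputable section

open Set MeasureTheory

namespace Summit.RiemannHypothesis.RiemannHypothesis.Theorems.PolarPerronFrobenius

open Literature.NumberTheory.LFunctions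

/-- **`0 ≤ ε(83/100)`**, from W-M4 `WeilPositivityOn 1` (format C, weil-2) by monotonicity in the window. [folklore] -/
theorem weilGroundEnergy_83_nonneg_of_one : 0 ≤ weilGroundEnergy (83 / 100 : ℝ) :=
  (weilGroundEnergy_nonneg_iff_holds (a := (83 / 100 : ℝ)) (by norm_num)).2
    (WeilFormatCData.A1.weilPositivityOn_one.mono (by norm_num))

/-- **The cone gap at `a = 83/100` lies in `[0, 483·10⁻²¹]`, unconditionally.** [folklore] -/
theorem coneGap_83 :
    0 ≤ sInf (weilWindowSphereValues (fun g : ℝ → ℂ ↦ ∀ t, (g t).im = 0 ∧ 0 ≤ (g t).re) (83 / 100 : ℝ)) -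
        weilGroundEnergy (83 / 100 : ℝ) ∧
      sInf (weilWindowSphereValues (fun g : ℝ → ℂ ↦ ∀ t, (g t).im = 0 ∧ 0 ≤ (g t).re) (83 / 100 : ℝ)) -
        weilGroundEnergy (83 / 100 : ℝ) ≤ 483 / 1000000000000000000000 :=
  coneGap_83_le weilGroundEnergy_83_nonneg_of_one

/-- **Uniform cone gap `≤ 10⁻¹⁷` on `[4023/5000, 83/100]`, unconditionally.** [folklore] -/
theorem coneGap_le_of_mem_Icc_8046_83 {a : ℝ} (ha : a ∈ Icc (4023 / 5000 : ℝ) (83 / 100)) :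
    0 ≤ sInf (weilWindowSphereValues (fun g : ℝ → ℂ ↦ ∀ t, (g t).im = 0 ∧ 0 ≤ (g t).re) a) - weilGroundEnergy a ∧
      sInf (weilWindowSphereValues (fun g : ℝ → ℂ ↦ ∀ t, (g t).im = 0 ∧ 0 ≤ (g t).re) a) - weilGroundEnergy a ≤
        1 / 100000000000000000 :=
  coneGap_le_of_mem_Icc_8046 weilGroundEnergy_83_nonneg_of_one ha

end Summit.RiemannHypothesis.RiemannHypothesis.Theorems.PolarPerronFrobenius

end
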